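import Mathlib
import Summits.MatrixMultiplication.MatrixMultiplication.Theses.FourierTwoFamiliesModP

/-!
# `PrimeTwoFamilies` (crux stmt-MatrixMultiplication-14308): SIGNED (mirror-free) two-families
# designs never cross the wall `Σ |Aᵢ||Bᵢ| ≤ |G|` — the strengthening `SignedPrimeTwoFamilies`
# (crux idea `polarized-pairs-signed-designs`, `Cruxes/PrimeTwoFamilies/SketchIdeatorFive.lean`) is FALSE

Negative-side lemma (refuter, crux-triage round 2).  Everything `sorry`-free, Mathlib + route file only.

A MIRROR of a family `(Aᵢ, Bᵢ)_{i<n}` in an abelian group is a coincidence `a + b' = a' + b` with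
`a ∈ A i, b ∈ B i, a' ∈ A k, b' ∈ B k`, `i ≠ k` (a point of `(A i + B k) ∩ (A k + B i)`); clause (X) of
the SDPP allows mirrors, and "signed" = SDPP + no mirrors (card §Lever).  The observation:

* `a + b' = a' + b ↔ a - b = a' - b'` — a mirror is exactly a common point of the DIFFERENCE sets
  `A i - B i` and `A k - B k`; directness (W) makes `(a, b) ↦ a - b` injective on `A i × B i`.  Hence
  `sum_card_mul_card_le_of_noMirror`: a mirror-free (W)-family has `Σ_i |A i|·|B i| ≤ |G|`
  (the difference sets are pairwise disjoint of sizes `|A i||B i|`), and dually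
  `exists_mirror_of_card_lt_sum`: every (W)-family beyond the wall has a mirror.
* `noMirror_of_disjoint_regions`: the card's sign-region condition `Disjoint (A i + ⋃_{k≠i} B k)
  ((⋃_{j≠i} A j) + B i)` excludes mirrors; so `not_signedPrimeTwoFamilies`: the transfer target
  `SignedPrimeTwoFamilies` (the crux with (X) replaced by signedness, stated here with `IsSigned`
  unfolded verbatim) is false — a witness of slice `δ` would give `n · n^{2-δ} ≤ p ≤ n^{2+δ}`, i.e.
  `n^{1-2δ} ≤ 1`, impossible for `δ < 1/2`, `n ≥ 2` (`half_le_of_noMirror_witness`: mirror-free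
  witnesses exist only for `δ ≥ 1/2`, the translate line `θ + γ ≤ 1` of `Negative/Translates.lean`).

Consequently signedness is not an `o(1)`-cost normal form: near the apex `δ → 0` every witness is
mirrored on `≥ n^{2-2δ}/2` index pairs (pigeonhole on the difference sets; not formalised here).
-/

namespace Summit.MatrixMultiplication.MatrixMultiplication.Theorems.PrimeTwoFamilies.Negative

open Finset
open scoped Pointwise

section Wall

variable {G : Type*} [AddCommGroup G] {n : ℕ}

/-- **Mirror-free direct families pack their difference sets.**  If every pair `(A i, B i)` is
direct ((W)) and no two distinct indices mirror, then `Σ_i |A i|·|B i| ≤ |G|`. -/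
theorem sum_card_mul_card_le_of_noMirror [Fintype G] (A B : Fin n → Finset G)
    (hW : ∀ i : Fin n, ∀ a ∈ A i, ∀ a' ∈ A i, ∀ b ∈ B i, ∀ b' ∈ B i,
      (a - a') + (b - b') = 0 → a = a' ∧ b = b')
    (hM : ∀ i k : Fin n, i ≠ k → ∀ a ∈ A i, ∀ b ∈ B i, ∀ a' ∈ A k, ∀ b' ∈ B k,
      a + b' ≠ a' + b) :
    ∑ i, (A i).card * (B i).card ≤ Fintype.card G := by
  classical
  set T : Finset (Σ _ : Fin n, G × G) := univ.sigma fun i => A i ×ˢ B i with hT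
  have hcard : T.card = ∑ i, (A i).card * (B i).card := by
    rw [hT, card_sigma]
    simp only [card_product]
  have hinj : Set.InjOn (fun x : (Σ _ : Fin n, G × G) => x.2.1 - x.2.2) (T : Set _) := by
    rintro ⟨i, a, b⟩ hi ⟨k, a', b'⟩ hk h
    simp only [hT, coe_sigma, coe_product, Set.mem_sigma_iff, coe_univ, Set.mem_univ,
      Set.mem_prod, mem_coe, true_and] at hi hk
    have h' : a + b' = a' + b := sub_eq_sub_iff_add_eq_add.1 h
    by_cases hik : i = k
    · subst hik
      have h0 : (a - a') + (b' - b) = 0 := by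
        have e : (a - a') + (b' - b) = (a + b') - (a' + b) := by abel
        rw [e, h', sub_self]
      obtain ⟨rfl, rfl⟩ := hW i a hi.1 a' hk.1 b' hk.2 b hi.2 h0
      rfl
    · exact absurd h' (hM i k hik a hi.1 b hi.2 a' hk.1 b' hk.2)
  calc ∑ i, (A i).card * (B i).card = T.card := hcard.symm
    _ ≤ (univ : Finset G).card :=
        card_le_card_of_injOn (fun x => x.2.1 - x.2.2) (fun _ _ => mem_univ _) hinj
    _ = Fintype.card G := card_univ

/-- Dually: **a direct family beyond the wall has a mirror.** -/
theorem exists_mirror_of_card_lt_sum [Fintype G] (A B : Fin n → Finset G)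
    (hW : ∀ i : Fin n, ∀ a ∈ A i, ∀ a' ∈ A i, ∀ b ∈ B i, ∀ b' ∈ B i,
      (a - a') + (b - b') = 0 → a = a' ∧ b = b')
    (hlt : Fintype.card G < ∑ i, (A i).card * (B i).card) :
    ∃ i k : Fin n, i ≠ k ∧ ∃ a ∈ A i, ∃ b ∈ B i, ∃ a' ∈ A k, ∃ b' ∈ B k, a + b' = a' + b := by
  by_contra hcon
  push Not at hcon
  exact absurd (sum_card_mul_card_le_of_noMirror A B hW hcon) (not_le.2 hlt)

/-- The sign-region disjointness of a SIGNED family (card `polarized-pairs-signed-designs`: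
`Disjoint (regP i) (regN i)`, `regP i = A i + ⋃_{k ≠ i} B k`, `regN i = (⋃_{j ≠ i} A j) + B i`)
excludes mirrors. -/
theorem noMirror_of_disjoint_regions [DecidableEq G] (A B : Fin n → Finset G)
    (hPN : ∀ i : Fin n, Disjoint (A i + (univ.erase i).biUnion B) ((univ.erase i).biUnion A + B i)) :
    ∀ i k : Fin n, i ≠ k → ∀ a ∈ A i, ∀ b ∈ B i, ∀ a' ∈ A k, ∀ b' ∈ B k, a + b' ≠ a' + b := by
  intro i k hik a ha b hb a' ha' b' hb' h
  have zP : a + b' ∈ A i + (univ.erase i).biUnion B :=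
    add_mem_add ha (mem_biUnion.2 ⟨k, mem_erase.2 ⟨fun e => hik e.symm, mem_univ _⟩, hb'⟩)
  have zN : a' + b ∈ (univ.erase i).biUnion A + B i :=
    add_mem_add (mem_biUnion.2 ⟨k, mem_erase.2 ⟨fun e => hik e.symm, mem_univ _⟩, ha'⟩) hb
  rw [← h] at zN
  exact disjoint_left.1 (hPN i) zP zN

/-- The wall for signed families: `Σ_i |A i|·|B i| ≤ |G|`. -/
theorem sum_card_mul_card_le_of_signed [Fintype G] [DecidableEq G] (A B : Fin n → Finset G)
    (hW : ∀ i : Fin n, ∀ a ∈ A i, ∀ a' ∈ A i, ∀ b ∈ B i, ∀ b' ∈ B i,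
      (a - a') + (b - b') = 0 → a = a' ∧ b = b')
    (hPN : ∀ i : Fin n, Disjoint (A i + (univ.erase i).biUnion B) ((univ.erase i).biUnion A + B i)) :
    ∑ i, (A i).card * (B i).card ≤ Fintype.card G :=
  sum_card_mul_card_le_of_noMirror A B hW (noMirror_of_disjoint_regions A B hPN)

end Wall

/-! ## The strengthening `SignedPrimeTwoFamilies` is false -/

/-- **Mirror-free witnesses live on the translate line.**  A mirror-free direct family of `n ≥ 2`
pairs in `ℤ/p` with `p ≤ n^{2+δ}` and `|A i||B i| ≥ n^{2-δ}` forces `1/2 ≤ δ`. -/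
theorem half_le_of_noMirror_witness {n p : ℕ} [NeZero p] (hn : 2 ≤ n) {δ : ℝ}
    (A B : Fin n → Finset (ZMod p))
    (hW : ∀ i : Fin n, ∀ a ∈ A i, ∀ a' ∈ A i, ∀ b ∈ B i, ∀ b' ∈ B i,
      (a - a') + (b - b') = 0 → a = a' ∧ b = b')
    (hM : ∀ i k : Fin n, i ≠ k → ∀ a ∈ A i, ∀ b ∈ B i, ∀ a' ∈ A k, ∀ b' ∈ B k,
      a + b' ≠ a' + b)
    (hp : (p : ℝ) ≤ (n : ℝ) ^ (2 + δ))
    (hAB : ∀ i : Fin n, (n : ℝ) ^ (2 - δ) ≤ (((A i).card * (B i).card : ℕ) : ℝ)) :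
    1 / 2 ≤ δ := by
  have hwall := sum_card_mul_card_le_of_noMirror A B hW hM
  rw [ZMod.card] at hwall
  have hn0 : (0 : ℝ) < n := by exact_mod_cast (show 0 < n by omega)
  have hn1 : (1 : ℝ) < n := by exact_mod_cast (show 1 < n by omega)
  -- n * n^(2-δ) ≤ Σ |A i||B i| ≤ p ≤ n^(2+δ)
  have hsum : (n : ℝ) * (n : ℝ) ^ (2 - δ) ≤ (n : ℝ) ^ (2 + δ) := by
    calc (n : ℝ) * (n : ℝ) ^ (2 - δ) = ∑ _i : Fin n, (n : ℝ) ^ (2 - δ) := by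
          rw [sum_const, card_univ, Fintype.card_fin, nsmul_eq_mul]
      _ ≤ ∑ i : Fin n, (((A i).card * (B i).card : ℕ) : ℝ) := sum_le_sum fun i _ => hAB i
      _ = ((∑ i : Fin n, (A i).card * (B i).card : ℕ) : ℝ) := by push_cast; rfl
      _ ≤ (p : ℝ) := by exact_mod_cast hwall
      _ ≤ (n : ℝ) ^ (2 + δ) := hp
  have hpow : (n : ℝ) ^ (3 - δ) ≤ (n : ℝ) ^ (2 + δ) := by
    have e : (3 - δ : ℝ) = 1 + (2 - δ) := by ring
    rw [e, Real.rpow_add hn0, Real.rpow_one]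
    exact hsum
  by_contra hδ
  push Not at hδ
  have : (n : ℝ) ^ (2 + δ) < (n : ℝ) ^ (3 - δ) :=
    Real.rpow_lt_rpow_of_exponent_lt hn1 (by linarith)
  linarith

/-- **`SignedPrimeTwoFamilies` is false.**  The statement below is the transfer target `C⁺` of card
`polarized-pairs-signed-designs` (`Cruxes/PrimeTwoFamilies/SketchIdeatorFive.lean`) with `IsSigned`,
`regL/regP/regN`, `othA/othB` unfolded verbatim: the crux `PrimeTwoFamilies` with clause (X) replaced
by pairwise disjointness of the three sign regions of every index. -/
theorem not_signedPrimeTwoFamilies :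
    ¬ (∀ δ : ℝ, 0 < δ → ∀ n₀ : ℕ, ∃ n ≥ n₀, ∃ p : ℕ, p.Prime ∧ ∃ A B : Fin n → Finset (ZMod p),
      (∀ i : Fin n, ∀ a ∈ A i, ∀ a' ∈ A i, ∀ b ∈ B i, ∀ b' ∈ B i,
          (a - a') + (b - b') = 0 → a = a' ∧ b = b') ∧
      (∀ i : Fin n,
          Disjoint (A i + B i) (A i + (univ.erase i).biUnion B) ∧
          Disjoint (A i + B i) ((univ.erase i).biUnion A + B i) ∧
          Disjoint (A i + (univ.erase i).biUnion B) ((univ.erase i).biUnion A + B i)) ∧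
      (p : ℝ) ≤ (n : ℝ) ^ (2 + δ) ∧
      ∀ i : Fin n, (n : ℝ) ^ (2 - δ) ≤ (((A i).card * (B i).card : ℕ) : ℝ)) := by
  intro h
  obtain ⟨n, hn, p, hp, A, B, hW, hS, hpn, hAB⟩ := h (1 / 4) (by norm_num) 2
  haveI : NeZero p := ⟨hp.ne_zero⟩
  have := half_le_of_noMirror_witness hn A B hW
    (noMirror_of_disjoint_regions A B fun i => (hS i).2.2) hpn hAB
  norm_num at this

end Summit.MatrixMultiplication.MatrixMultiplication.Theorems.PrimeTwoFamilies.Negative
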